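import Literature.MathematicalPhysics.QuantumFieldTheory.Balaban1983to89.B13TermWalkData

/-!
# `Balaban1983to89.B13TermWalkDataOneTorus` — what the NODE-O statement (v) of `B13TermWalkData` does and does NOT say
ON ONE FINITE TORUS, in the kernel: (§1–§2) the shapes are CONSISTENT — `TermWalkData` ∕ `ExistsWalkDataUniform` are
inhabited at the FREE term (identity precision, zero Γ-kernel); (§3) AS TYPED, on one finite torus
`ExistsWalkDataUniform` is inhabited by ONE-TERM JUNK for ANY family of kernels that is merely BOUNDED and
u-differentiable (walk distance := the detour through a point of `X`, walk rate `0`, the torus decay ABSORBED into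
`K̄ = B·e^{κ·diam₁ T}`) — so (v)'s content lives ONLY in the torus∕scale-UNIFORMITY of the constants
(`ExistsUniformAcross`) and in the SMALLNESS of `θ_• = 2K̄_•(e^{−εR_σ} + α∕R)` that NODE A consumes; (§4) that
smallness as a `Prop` (`SmallTheta`), (v)⁺ := admissible ∧ small ∧ serving every term (`ExistsWalkDataUniformSmall`,
`ExistsUniformAcrossSmall`), the junk package FAILS it (`junk_not_smallTheta`), genuine decay MEETS it
(`smallTheta_of_decay`, `acrossSmall_of_decay`)

statement-level skeleton of published theorems with citation tags; proofs where landed; nothing here is a claim about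
the Yang–Mills mass gap

PROVENANCE.  Cell `pub-balaban-gaps`, track G1, row (D4) NODE O.  §1–§2: prover seat g1-p2 gen 3.  §3–§4 up to
`smallTheta_of_decay`: planner seat g1-plan-2 GEN 9 (lens structural ∕ reformulation), XREAD appendix
`HOME/g1/skeletons/XreadWalkTargetOneTorus_plan2.append.lean` v1.1 (its X-11 ∕ R-2 ∕ R-3 finding on g1-plan-1's skeleton
#6).  §4 from `ExistsUniformAcrossSmall` on: g1-plan-1 GEN 9, `HOME/g1/skeletons/D4NodeOWalkTarget.acrossSmall.append.lean`
v1 (adopting X-11).  Both offered to this seat «adopt ∕ reword ∕ ignore» ([G1-PLAN1-G9-RE-INTENT-15],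
[G1-PLAN1-G9-ACROSS-SMALL]) and FILED by g1-p2 gen 3 with declarations byte-identical except namespaces
(`Summit.…D4NodeOWalkTarget[.XreadPlan2]` → this Literature namespace), provenance tags (public `[folklore]` → the
printed locus served; helpers `private`) and docstrings on two helper lemmas.  Sources: [Balaban1988RG2Cluster] p. 5
(1.11), p. 13, p. 15, (2.16) p. 16; [Balaban1985BackgroundPropagators] Thm 3.10 p. 416 (quoted verbatim, render-checked,
in `B13SigmaThroughWalks` ∕ `B13JointWalkExpansion`).

CENSUS MEANING (row (D4).NODE-O; words UNCHANGED): THE FIRST MISSING LEMMA OF ROW (D4) AT NODE O is typed as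
`ExistsUniformAcrossSmall 𝓣 α Rσ₀ θ₀` — ONE admissible AND SMALL package for every member of Bałaban's exhausting family
and every term (G-B9-10 + O.2 (v) + NODE A's threshold `θ₀`); `B13TermWalkData.ExistsWalkDataUniform` on one torus is
necessary bookkeeping but, alone, junk-inhabited (§3).
HONEST SCOPE.  Consistency ∕ junk witnesses for hypothesis SHAPES and two `Prop`s; nothing of Bałaban's constructed or
asserted; (D4) NOT discharged (instance 0∕1).  MODEL data defs: `freeKernels`, `freeConsts`, `diam1`.  No `sorry`, no
named fact.  NOT B12 Thm 2, NOT `BetaPertH`, NOT continuum ∕ ℝ⁴, NOT Clay.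
-/

noncomputable section

namespace Literature.MathematicalPhysics.QuantumFieldTheory.Balaban1983to89.B13TermWalkDataOneTorus

open Metric Set Matrix Finset
open Literature.MathematicalPhysics.QuantumFieldTheory.Balaban1983to89
open Literature.MathematicalPhysics.QuantumFieldTheory.Balaban1983to89.B9SectDWalk (Through MajSumLe)
open Literature.MathematicalPhysics.QuantumFieldTheory.Balaban1983to89.B9Thm34Ext (toB6)
open Literature.MathematicalPhysics.QuantumFieldTheory.Balaban1983to89.B9Thm37GlueTorus (torusGeom tdist1 tdist1_nonneg
  tdist1_self)
open Literature.MathematicalPhysics.QuantumFieldTheory.Balaban1983to89.TreeLengthTorus (TPt)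
open Literature.MathematicalPhysics.QuantumFieldTheory.Balaban1983to89.B5TorusCover (UT)
open Literature.MathematicalPhysics.QuantumFieldTheory.Balaban1983to89.B13JointWalkExpansion
  (JointWalkExpansion WalkMajorants)
open Literature.MathematicalPhysics.QuantumFieldTheory.Balaban1983to89.B13TermWalkData
  (WalkConsts TermKernels TermWalkData ExistsWalkDataUniform TorusTerms ExistsUniformAcross)

section FreeTerm

variable {d N' : ℕ} {ν : ℕ} {Nf : Fin ν → ℕ} [∀ i, NeZero (Nf i)]
variable {E : Type*} [NormedAddCommGroup E] [NormedSpace ℂ E]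

/-! ## §1. The free term and its constant package -/

/-- MODEL. The `TermKernels` record of the FREE term on a finite bond set `Λ` located on the site torus: precision
`A(σ,u) = 1`, Γ-kernel `G(σ,u) = 0`, references `Γ₀ = 0`, `C = 1`, no σ-carrying region (`X = ∅`), fibre bound `|Λ|`.
[cite: Balaban1988RG2Cluster, (2.14)–(2.16) pp.15–16 (degenerate case)] -/
def freeKernels (c : B13.Consts) (E : Type*) [NormedAddCommGroup E] [NormedSpace ℂ E] (Λ : Type) [Fintype Λ]
    [DecidableEq Λ] (C₀ : Type) (locΛ : Λ → UT Nf) (locN : Λ ⊕ C₀ → UT Nf) : TermKernels c d N' ν Nf E where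
  Λ := Λ
  C₀ := C₀
  A2 := fun _ _ => 1
  G2 := fun _ _ => 0
  Γ₀ := 0
  C := 1
  locΛ := locΛ
  locN := locN
  X := ∅
  m := Fintype.card Λ
  hfib := fun _ => (Finset.card_filter_le _ _).trans Finset.card_univ.le
  hG0 := by simp
  hC0 := by rw [inv_one, Matrix.map_one _ (map_zero _) (map_one _)]
  hC := Matrix.PosDef.one

/-- MODEL. The free constant package `(R, ε, κ, K̄_Γ, K̄_E, K̄_C, R_σ) = (1, 0, 1, 0, 1, 1, 0)`. [cite: Balaban1988RG2Cluster, p.15] -/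
def freeConsts : WalkConsts := ⟨1, 0, 1, 0, 1, 1, 0⟩

/-- The free package is admissible for configurations of size `≤ ½` and σ-distance `0`. [cite: Balaban1988RG2Cluster, p.15] -/
theorem freeConsts_admissible : freeConsts.Admissible (1 / 2) 0 :=
  ⟨by norm_num [freeConsts], le_rfl, by norm_num [freeConsts], le_rfl, by norm_num [freeConsts],
    by norm_num [freeConsts], le_rfl⟩

/-! ## §2. The three objects at the free term; (v) for a family of free terms -/

/-- One-term majorant families on `Unit`: partial sums are bounded by the single member (non-negative). [folklore] -/
private theorem majSumLe_unit {g : B6.Geometry} {K Kbar : g.Site → g.Site → ℝ} (hK : ∀ a b, 0 ≤ K a b)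
    (hle : ∀ a b, K a b ≤ Kbar a b) : MajSumLe (fun (_ : Unit) a b => K a b) Kbar := by
  intro S a b
  calc ∑ _ω ∈ S, K a b ≤ ∑ _ω ∈ (Finset.univ : Finset Unit), K a b :=
        Finset.sum_le_sum_of_subset_of_nonneg (Finset.subset_univ S) fun _ _ _ => hK a b
    _ = K a b := by simp
    _ ≤ Kbar a b := hle a b

/-- The entries of the identity matrix are bounded by the torus-localised weight `e^{−d₁(loc i, loc j)}` (the diagonal
entry `1` sits at distance `0`, the others vanish). [folklore] -/
private theorem one_apply_le {Λ : Type} [Fintype Λ] [DecidableEq Λ] (locΛ : Λ → UT Nf) (i j : Λ) :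
    ‖(1 : Matrix Λ Λ ℂ) i j‖ ≤ 1 * Real.exp (-(1 * tdist1 Nf (locΛ i) (locΛ j))) := by
  by_cases h : i = j
  · subst h; simp [tdist1_self]
  · rw [Matrix.one_apply_ne h, norm_zero]; positivity

/-- **The free term carries `TermWalkData` with the free package**: Γ-kernel `0` (one zero term), precision `1` and
covariance `1⁻¹ = 1` (one constant term each, amplitude `1`, walk distance the ℓ¹ torus distance, walk rate `1`), empty
σ-carrying sub-families, `X = ∅` (far-ness vacuous).  A consistency witness for the shapes — the degenerate printed case
`m = 0` for every term; nothing about Bałaban's kernels. [cite: Balaban1988RG2Cluster, (1.11) p.5, p.15] -/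
theorem termWalkData_free (c : B13.Consts) (Λ : Type) [Fintype Λ] [DecidableEq Λ] (C₀ : Type) (locΛ : Λ → UT Nf)
    (locN : Λ ⊕ C₀ → UT Nf) :
    TermWalkData (freeKernels (d := d) (N' := N') c E Λ C₀ locΛ locN) freeConsts where
  hΓ := by
    refine ⟨Unit, fun _ _ _ => 0, ∅, fun _ => 0, fun _ => tdist1 Nf, 1, ?_⟩
    exact ⟨fun σ _ u _ i j => hasSum_unique (fun _ : Unit => (freeKernels (d := d) (N' := N') c E Λ C₀ locΛ locN).G2 σ u i j), fun _ σ _ i j => differentiableOn_const _,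
      fun _ σ _ u _ i j => by simp [freeKernels], majSumLe_unit (fun a b => by simp) (fun a b => by simp [freeConsts]),
      fun _ _ σ _ => rfl, fun ω hω => by simp at hω, fun _ => le_rfl, fun _ a b => tdist1_nonneg a b⟩
  hE := by
    refine ⟨Unit, fun _ _ _ => 1, ∅, fun _ => 1, fun _ => tdist1 Nf, 1, ?_⟩
    exact ⟨fun σ _ u _ i j => hasSum_unique (fun _ : Unit => (freeKernels (d := d) (N' := N') c E Λ C₀ locΛ locN).A2 σ u i j), fun _ σ _ i j => differentiableOn_const _,
      fun _ σ _ u _ i j => one_apply_le locΛ i j,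
      majSumLe_unit (fun a b => by positivity) (fun a b => by simp [freeConsts]),
      fun _ _ σ _ => rfl, fun ω hω => by simp at hω, fun _ => zero_le_one, fun _ a b => tdist1_nonneg a b⟩
  hCov := by
    refine ⟨Unit, fun _ σ u => ((freeKernels (d := d) (N' := N') c E Λ C₀ locΛ locN).A2 σ u)⁻¹, fun _ => 1, fun _ => tdist1 Nf, 1, ?_⟩
    exact ⟨fun σ _ u _ i j => hasSum_unique (fun _ : Unit => ((freeKernels (d := d) (N' := N') c E Λ C₀ locΛ locN).A2 σ u)⁻¹ i j), fun _ σ _ u _ i j => by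
        convert one_apply_le (Nf := Nf) locΛ i j using 2 <;>
          first | rfl | (change ((1 : Matrix Λ Λ ℂ))⁻¹ i j = (1 : Matrix Λ Λ ℂ) i j; rw [inv_one]),
      majSumLe_unit (fun a b => by positivity) (fun a b => by simp [freeConsts]), fun _ => zero_le_one⟩
  hfar := fun b z hz => by simp [freeKernels] at hz

/-- **(v) IS INHABITED at any family of free terms** (one package for all of them): `ExistsWalkDataUniform` with
`α = ½`, `Rσ₀ = 0`. [cite: Balaban1988RG2Cluster, p.13, p.15] -/
theorem existsWalkDataUniform_free (c : B13.Consts) {ι : Type*} (Λ : ι → Type) [∀ i, Fintype (Λ i)]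
    [∀ i, DecidableEq (Λ i)] (C₀ : ι → Type) (locΛ : ∀ i, Λ i → UT Nf) (locN : ∀ i, Λ i ⊕ C₀ i → UT Nf) :
    ExistsWalkDataUniform (fun i => freeKernels (d := d) (N' := N') c E (Λ i) (C₀ i) (locΛ i) (locN i)) (1 / 2) 0 :=
  ⟨freeConsts, freeConsts_admissible, fun i => termWalkData_free c (Λ i) (C₀ i) (locΛ i) (locN i)⟩

end FreeTerm

/-! ## §3. ONE TORUS: (v) as typed is inhabited by one-term JUNK for any bounded, u-differentiable family (g1-plan-2, X-11) -/

section OneTorusJunk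

variable {d N' : ℕ} {ν : ℕ} {Nf : Fin ν → ℕ} [∀ i, NeZero (Nf i)]
variable {p n : Type}
variable {E : Type*} [NormedAddCommGroup E] [NormedSpace ℂ E]

/-- The `d₁`-diameter of the finite site torus (a finite `sup'`; `0` on an empty torus). [folklore] -/
def diam1 (Nf : Fin ν → ℕ) [∀ i, NeZero (Nf i)] : ℝ :=
  if h : (Finset.univ : Finset (UT Nf × UT Nf)).Nonempty then
    Finset.univ.sup' h (fun ab : UT Nf × UT Nf => tdist1 Nf ab.1 ab.2) else 0

/-- Every torus distance is below the diameter. [folklore] -/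
private theorem tdist1_le_diam1 (a b : UT Nf) : tdist1 Nf a b ≤ diam1 Nf := by
  have h : (Finset.univ : Finset (UT Nf × UT Nf)).Nonempty := ⟨(a, b), Finset.mem_univ _⟩
  rw [diam1, dif_pos h]
  exact Finset.le_sup' (fun ab : UT Nf × UT Nf => tdist1 Nf ab.1 ab.2) (Finset.mem_univ (a, b))

/-- The diameter of a non-empty torus is non-negative. [folklore] -/
private theorem diam1_nonneg [Nonempty (UT Nf)] : 0 ≤ diam1 Nf := by
  obtain ⟨a⟩ := ‹Nonempty (UT Nf)›
  have := tdist1_le_diam1 a a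
  rw [B9Thm37GlueTorus.tdist1_self] at this
  exact this

/-- The junk bound `B ≤ B·e^{κ·diam}·e^{−κ d₁(a,b)}` (decay absorbed into the constant on a finite torus). [folklore] -/
private theorem junk_bound {B kap : ℝ} (hB : 0 ≤ B) (hkap : 0 ≤ kap) (a b : UT Nf) :
    B ≤ B * Real.exp (kap * diam1 Nf) * Real.exp (-(kap * tdist1 Nf a b)) := by
  rw [mul_assoc, ← Real.exp_add]
  have h0 : 0 ≤ kap * diam1 Nf + -(kap * tdist1 Nf a b) := by nlinarith [tdist1_le_diam1 a b]
  calc B = B * 1 := (mul_one B).symm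
    _ ≤ B * Real.exp (kap * diam1 Nf + -(kap * tdist1 Nf a b)) :=
        mul_le_mul_of_nonneg_left (Real.one_le_exp h0) hB

/-- **JUNK WITNESS for `JointWalkExpansion` on one torus**: a kernel family bounded by `B` and differentiable in `u`
is a ONE-TERM "joint walk expansion" (`W = Unit`, `SX = univ`, detour distance through `z₀ ∈ X`, `ρ = 0`, `ε = 0`,
`K̄ = B·e^{κ·diam}`): AS TYPED the shape forgets the walk structure on one finite torus. [cite: Balaban1985BackgroundPropagators, Thm 3.10 p.416; Balaban1988RG2Cluster, p.13] -/
theorem jointWalkExpansion_junk (c : B13.Consts) (locp : p → UT Nf) (locn : n → UT Nf)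
    (K2 : (TPt d N' → ℂ) → E → Matrix p n ℂ) (X : Finset (UT Nf)) {z₀ : UT Nf} (hz₀ : z₀ ∈ X)
    {R B kap : ℝ} (hB : 0 ≤ B) (hkap : 0 ≤ kap)
    (hbd : ∀ σ : TPt d N' → ℂ, (∀ j, ‖σ j‖ ≤ Real.exp c.κ₁) → ∀ u ∈ ball (0 : E) R, ∀ i j, ‖K2 σ u i j‖ ≤ B)
    (han : ∀ σ : TPt d N' → ℂ, (∀ j, ‖σ j‖ ≤ Real.exp c.κ₁) →
      ∀ i j, DifferentiableOn ℂ (fun u => K2 σ u i j) (ball (0 : E) R)) :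
    JointWalkExpansion c locp locn K2 X R 0 kap (B * Real.exp (kap * diam1 Nf))
      (fun (_ : Unit) => K2) (Set.univ : Set Unit) (fun _ => B)
      (fun _ y y' => tdist1 Nf y z₀ + tdist1 Nf z₀ y') 0 where
  hasSum σ hσ u hu i j := by simp
  termAnalytic _ σ hσ i j := han σ hσ i j
  maj _ σ hσ u hu i j := (hbd σ hσ u hu i j).trans_eq (by simp)
  majSum := by
    intro S a b
    have hS : (S.card : ℝ) ≤ 1 := by exact_mod_cast (Finset.card_le_univ S).trans_eq Fintype.card_unit
    simp only [sub_self, zero_mul, neg_zero, Real.exp_zero, mul_one, Finset.sum_const, nsmul_eq_mul]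
    calc (S.card : ℝ) * B ≤ 1 * B := by gcongr
      _ ≤ B * Real.exp (kap * diam1 Nf) * Real.exp (-(kap * tdist1 Nf a b)) := by
          rw [one_mul]; exact junk_bound hB hkap a b
  indep ω hω := (hω (Set.mem_univ ω)).elim
  through _ _ y y' := ⟨z₀, hz₀, le_rfl⟩
  A_nonneg _ := hB
  D_nonneg _ a b := add_nonneg (tdist1_nonneg a z₀) (tdist1_nonneg z₀ b)

omit [NormedSpace ℂ E] in
/-- **JUNK WITNESS for `WalkMajorants`** (no analyticity needed): bounded ⟹ one-term majorants with `K̄ = B·e^{κ·diam}`.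
[cite: Balaban1985BackgroundPropagators, (3.108) p.416] -/
theorem walkMajorants_junk (c : B13.Consts) (locp : p → UT Nf) (locn : n → UT Nf)
    (K2 : (TPt d N' → ℂ) → E → Matrix p n ℂ) (z₀ : UT Nf) {R B kap : ℝ} (hB : 0 ≤ B) (hkap : 0 ≤ kap)
    (hbd : ∀ σ : TPt d N' → ℂ, (∀ j, ‖σ j‖ ≤ Real.exp c.κ₁) → ∀ u ∈ ball (0 : E) R, ∀ i j, ‖K2 σ u i j‖ ≤ B) :
    WalkMajorants c locp locn K2 R kap (B * Real.exp (kap * diam1 Nf))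
      (fun (_ : Unit) => K2) (fun _ => B) (fun _ y y' => tdist1 Nf y z₀ + tdist1 Nf z₀ y') 0 where
  hasSum σ hσ u hu i j := by simp
  maj _ σ hσ u hu i j := (hbd σ hσ u hu i j).trans_eq (by simp)
  majSum := by
    intro S a b
    have hS : (S.card : ℝ) ≤ 1 := by exact_mod_cast (Finset.card_le_univ S).trans_eq Fintype.card_unit
    simp only [zero_mul, neg_zero, Real.exp_zero, mul_one, Finset.sum_const, nsmul_eq_mul]
    calc (S.card : ℝ) * B ≤ 1 * B := by gcongr
      _ ≤ B * Real.exp (kap * diam1 Nf) * Real.exp (-(kap * tdist1 Nf a b)) := by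
          rw [one_mul]; exact junk_bound hB hkap a b
  A_nonneg _ := hB

/-- **ONE TERM, ONE TORUS: `TermWalkData` from boundedness + `u`-differentiability alone** (+ `X ≠ ∅`, + `hfar`).
No walk structure, no decay, no σ-localisation is used. [cite: Balaban1988RG2Cluster, p.13, p.15] -/
theorem termWalkData_junk {c : B13.Consts} (𝒦 : TermKernels c d N' ν Nf E) {z₀ : UT Nf} (hz₀ : z₀ ∈ 𝒦.X)
    {R B kap Rσ : ℝ} (hB : 0 ≤ B) (hkap : 0 ≤ kap)
    (hG : ∀ σ : TPt d N' → ℂ, (∀ j, ‖σ j‖ ≤ Real.exp c.κ₁) → ∀ u ∈ ball (0 : E) R, ∀ i j, ‖𝒦.G2 σ u i j‖ ≤ B)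
    (haG : ∀ σ : TPt d N' → ℂ, (∀ j, ‖σ j‖ ≤ Real.exp c.κ₁) →
      ∀ i j, DifferentiableOn ℂ (fun u => 𝒦.G2 σ u i j) (ball (0 : E) R))
    (hA : ∀ σ : TPt d N' → ℂ, (∀ j, ‖σ j‖ ≤ Real.exp c.κ₁) → ∀ u ∈ ball (0 : E) R, ∀ i j, ‖𝒦.A2 σ u i j‖ ≤ B)
    (haA : ∀ σ : TPt d N' → ℂ, (∀ j, ‖σ j‖ ≤ Real.exp c.κ₁) →
      ∀ i j, DifferentiableOn ℂ (fun u => 𝒦.A2 σ u i j) (ball (0 : E) R))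
    (hC : ∀ σ : TPt d N' → ℂ, (∀ j, ‖σ j‖ ≤ Real.exp c.κ₁) → ∀ u ∈ ball (0 : E) R, ∀ i j, ‖(𝒦.A2 σ u)⁻¹ i j‖ ≤ B)
    (hfar : ∀ b : 𝒦.Λ, ∀ z ∈ 𝒦.X, Rσ ≤ tdist1 Nf (𝒦.locΛ b) z) :
    TermWalkData 𝒦 ⟨R, 0, kap, B * Real.exp (kap * diam1 Nf), B * Real.exp (kap * diam1 Nf),
      B * Real.exp (kap * diam1 Nf), Rσ⟩ :=
  ⟨⟨Unit, fun _ => 𝒦.G2, Set.univ, fun _ => B, fun _ y y' => tdist1 Nf y z₀ + tdist1 Nf z₀ y', 0,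
      jointWalkExpansion_junk c 𝒦.locΛ 𝒦.locN 𝒦.G2 𝒦.X hz₀ hB hkap hG haG⟩,
    ⟨Unit, fun _ => 𝒦.A2, Set.univ, fun _ => B, fun _ y y' => tdist1 Nf y z₀ + tdist1 Nf z₀ y', 0,
      jointWalkExpansion_junk c 𝒦.locΛ 𝒦.locΛ 𝒦.A2 𝒦.X hz₀ hB hkap hA haA⟩,
    ⟨Unit, fun _ => fun σ u => (𝒦.A2 σ u)⁻¹, fun _ => B, fun _ y y' => tdist1 Nf y z₀ + tdist1 Nf z₀ y', 0,
      walkMajorants_junk c 𝒦.locΛ 𝒦.locΛ (fun σ u => (𝒦.A2 σ u)⁻¹) z₀ hB hkap hC⟩,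
    hfar⟩

/-- **(v) ON ONE TORUS FROM BOUNDEDNESS + ANALYTICITY ALONE** (any index type `ι`, no finiteness needed): if every
term's `G2`, `A2`, `(A2)⁻¹` are bounded by ONE `B` on polydisc × `R`-ball with `α < R`, `G2`, `A2` differentiable in `u`
there, every `X` non-empty and `hfar` at `Rσ₀`, then `ExistsWalkDataUniform 𝒦 α Rσ₀` — with the JUNK package
`(R, 0, κ, B·e^{κ·diam T}, B·e^{κ·diam T}, B·e^{κ·diam T}, Rσ₀)`.  So AS TYPED the one-torus statement carries no
random-walk ∕ locality content; (v)'s content is the torus∕scale-UNIFORMITY of `K̄` (`ExistsUniformAcross`) and the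
SMALLNESS of `θ` at NODE A. [cite: Balaban1988RG2Cluster, p.13, p.15; Balaban1985BackgroundPropagators, Thm 3.10 p.416] -/
theorem existsWalkDataUniform_junk {c : B13.Consts} {ι : Type*} [Nonempty (UT Nf)]
    (𝒦 : ι → TermKernels c d N' ν Nf E) {α Rσ₀ R B kap : ℝ} (hαR : α < R) (hB : 0 ≤ B) (hkap : 0 < kap)
    (hX : ∀ i, (𝒦 i).X.Nonempty)
    (hG : ∀ i, ∀ σ : TPt d N' → ℂ, (∀ j, ‖σ j‖ ≤ Real.exp c.κ₁) → ∀ u ∈ ball (0 : E) R, ∀ a b, ‖(𝒦 i).G2 σ u a b‖ ≤ B)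
    (haG : ∀ i, ∀ σ : TPt d N' → ℂ, (∀ j, ‖σ j‖ ≤ Real.exp c.κ₁) →
      ∀ a b, DifferentiableOn ℂ (fun u => (𝒦 i).G2 σ u a b) (ball (0 : E) R))
    (hA : ∀ i, ∀ σ : TPt d N' → ℂ, (∀ j, ‖σ j‖ ≤ Real.exp c.κ₁) → ∀ u ∈ ball (0 : E) R, ∀ a b, ‖(𝒦 i).A2 σ u a b‖ ≤ B)
    (haA : ∀ i, ∀ σ : TPt d N' → ℂ, (∀ j, ‖σ j‖ ≤ Real.exp c.κ₁) →
      ∀ a b, DifferentiableOn ℂ (fun u => (𝒦 i).A2 σ u a b) (ball (0 : E) R))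
    (hC : ∀ i, ∀ σ : TPt d N' → ℂ, (∀ j, ‖σ j‖ ≤ Real.exp c.κ₁) → ∀ u ∈ ball (0 : E) R,
      ∀ a b, ‖((𝒦 i).A2 σ u)⁻¹ a b‖ ≤ B)
    (hfar : ∀ i, ∀ b : (𝒦 i).Λ, ∀ z ∈ (𝒦 i).X, Rσ₀ ≤ tdist1 Nf ((𝒦 i).locΛ b) z) :
    ExistsWalkDataUniform 𝒦 α Rσ₀ := by
  have hK : 0 ≤ B * Real.exp (kap * diam1 Nf) := mul_nonneg hB (Real.exp_pos _).le
  refine ⟨⟨R, 0, kap, B * Real.exp (kap * diam1 Nf), B * Real.exp (kap * diam1 Nf), B * Real.exp (kap * diam1 Nf), Rσ₀⟩,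
    ⟨hαR, le_rfl, hkap, hK, hK, hK, le_rfl⟩, fun i => ?_⟩
  obtain ⟨z₀, hz₀⟩ := hX i
  exact termWalkData_junk (𝒦 i) hz₀ hB hkap.le (hG i) (haG i) (hA i) (haA i) (hC i) (hfar i)

/-- And the junk package's `θ_Γ = 2K̄(e^{−0·R_σ} + α∕R) ≥ 2B` is NOT small (`0 ≤ α`, `0 < R`, `0 ≤ κ`): the content
NODE A needs re-enters exactly through the smallness of `θ`, which `WalkConsts.Admissible` does not carry.
[cite: Balaban1988RG2Cluster, (2.16) p.16] -/
theorem junk_theta_not_small [Nonempty (UT Nf)] {B kap Rσ α R : ℝ} (hB : 0 ≤ B) (hkap : 0 ≤ kap) (hα : 0 ≤ α)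
    (hR : 0 < R) :
    2 * B ≤ 2 * (B * Real.exp (kap * diam1 Nf)) * Real.exp (-(0 * Rσ))
      + 2 * (B * Real.exp (kap * diam1 Nf)) * α / R := by
  have h1 : B ≤ B * Real.exp (kap * diam1 Nf) :=
    le_mul_of_one_le_right hB (Real.one_le_exp (mul_nonneg hkap diam1_nonneg))
  simp only [zero_mul, neg_zero, Real.exp_zero, mul_one]
  have h2 : 0 ≤ 2 * (B * Real.exp (kap * diam1 Nf)) * α / R := by positivity
  linarith

/-! ## §4. SMALLNESS (g1-plan-2 R-2, adopted by g1-plan-1): the SMALLNESS clause as a `Prop`, and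
(v)⁺ := admissible ∧ SMALL ∧ serving every term.  The junk package above FAILS it for every `θ₀ < 2B` — so (v)⁺, unlike
(v), is NOT inhabited by bounded-analytic junk: it is where [B9] Thm 3.10's decay `εR_σ = ⅓δ₀M ≫ 1` and the bigger
analyticity space `α∕R ≪ 1` do their work (NODE A's N1–N3).  Nothing of Bałaban's asserted. -/

/-- The smallness NODE A consumes: `θ_Γ, θ_E ≤ θ₀` with `θ_• := 2K̄_•(e^{−εR_σ} + α∕R)` (print: (1.11) ∕ [B9] (3.108)
with `εR_σ = ⅓δ₀M` large, and `α∕R` small from the bigger analyticity space). [cite: Balaban1988RG2Cluster, p.15, p.16] -/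
structure SmallTheta (w : WalkConsts) (α θ₀ : ℝ) : Prop where
  hΓ : 2 * w.KbarΓ * (Real.exp (-(w.ε * w.Rσ)) + α / w.R) ≤ θ₀
  hE : 2 * w.KbarE * (Real.exp (-(w.ε * w.Rσ)) + α / w.R) ≤ θ₀

/-- **(v)⁺ on one torus**: ONE admissible AND SMALL constant package serving every term of the family.
[cite: Balaban1988RG2Cluster, p.13, p.15, (2.16) p.16] -/
def ExistsWalkDataUniformSmall {c : B13.Consts} {ι : Type*} (𝒦 : ι → TermKernels c d N' ν Nf E)
    (α Rσ₀ θ₀ : ℝ) : Prop :=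
  ∃ w : WalkConsts, w.Admissible α Rσ₀ ∧ SmallTheta w α θ₀ ∧ ∀ i, TermWalkData (𝒦 i) w

/-- (v)⁺ ⟹ (v) (forget the smallness). [cite: Balaban1988RG2Cluster, p.15] -/
theorem existsUniform_of_small {c : B13.Consts} {ι : Type*} {𝒦 : ι → TermKernels c d N' ν Nf E} {α Rσ₀ θ₀ : ℝ}
    (h : ExistsWalkDataUniformSmall 𝒦 α Rσ₀ θ₀) : ExistsWalkDataUniform 𝒦 α Rσ₀ := by
  obtain ⟨w, ha, _, ht⟩ := h
  exact ⟨w, ha, ht⟩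

/-- The JUNK package of `existsWalkDataUniform_junk` is NOT small: it fails `SmallTheta` for every `θ₀ < 2B`
(`0 ≤ α`, `0 < R`, `0 ≤ κ`). [cite: Balaban1988RG2Cluster, (2.16) p.16] -/
theorem junk_not_smallTheta [Nonempty (UT Nf)] {B kap Rσ α R θ₀ : ℝ} (hB : 0 ≤ B) (hkap : 0 ≤ kap) (hα : 0 ≤ α)
    (hR : 0 < R) (hθ : θ₀ < 2 * B) :
    ¬ SmallTheta (⟨R, 0, kap, B * Real.exp (kap * diam1 Nf), B * Real.exp (kap * diam1 Nf),
        B * Real.exp (kap * diam1 Nf), Rσ⟩ : WalkConsts) α θ₀ := by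
  intro h
  have hΓ := h.hΓ
  dsimp only at hΓ
  have h1 := junk_theta_not_small (Nf := Nf) (Rσ := Rσ) (α := α) hB hkap hα hR
  have h2 : 2 * (B * Real.exp (kap * diam1 Nf)) * (Real.exp (-(0 * Rσ)) + α / R)
      = 2 * (B * Real.exp (kap * diam1 Nf)) * Real.exp (-(0 * Rσ))
        + 2 * (B * Real.exp (kap * diam1 Nf)) * α / R := by ring
  linarith

/-- Conversely a package with GENUINE decay is small: if `K̄_Γ, K̄_E ≤ K̄`, `0 ≤ K̄` and
`2K̄(e^{−εR_σ} + α∕R) ≤ θ₀` then `SmallTheta w α θ₀` — the shape in which [B9] Thm 3.10 (`εR_σ` large) and the bigger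
analyticity space (`α∕R` small) enter. [cite: Balaban1988RG2Cluster, (1.11) p.5, p.15; Balaban1985BackgroundPropagators, Thm 3.10 p.416] -/
theorem smallTheta_of_decay (w : WalkConsts) {α θ₀ Kbar : ℝ} (hKΓ : w.KbarΓ ≤ Kbar) (hKE : w.KbarE ≤ Kbar)
    (hsum : 0 ≤ Real.exp (-(w.ε * w.Rσ)) + α / w.R)
    (hθ : 2 * Kbar * (Real.exp (-(w.ε * w.Rσ)) + α / w.R) ≤ θ₀) : SmallTheta w α θ₀ := by
  refine ⟨?_, ?_⟩
  · calc 2 * w.KbarΓ * (Real.exp (-(w.ε * w.Rσ)) + α / w.R)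
        ≤ 2 * Kbar * (Real.exp (-(w.ε * w.Rσ)) + α / w.R) := by
          apply mul_le_mul_of_nonneg_right _ hsum; linarith
      _ ≤ θ₀ := hθ
  · calc 2 * w.KbarE * (Real.exp (-(w.ε * w.Rσ)) + α / w.R)
        ≤ 2 * Kbar * (Real.exp (-(w.ε * w.Rσ)) + α / w.R) := by
          apply mul_le_mul_of_nonneg_right _ hsum; linarith
      _ ≤ θ₀ := hθ

end OneTorusJunk

/-! ## §4 (continued). (v)⁺ ACROSS the exhausting family (g1-plan-1, adopting X-11) -/

section AcrossSmall



variable {d : ℕ} {c : B13.Consts}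

/-- **(v)⁺ IN FULL — THE FIRST MISSING LEMMA OF ROW (D4) AT NODE O, typed**: ONE admissible AND SMALL constant package
for every member `𝓣 s` of the exhausting family and every term of it.  `θ₀` is NODE A's threshold (numerics N1–N3);
print: `θ = O(1)e^{−⅓δ₀M} + O(α₀ + α₁)` small by `M` large ([B9] Thm 3.10, `εR_σ = ⅓δ₀M`) and the bigger analyticity
space (`α∕R` small).  STATEMENT ONLY. [cite: Balaban1988RG2Cluster, p.13, p.15, (2.16) p.16; Balaban1985BackgroundPropagators, Thm 3.10 p.416] -/
def ExistsUniformAcrossSmall {S : Type*} (𝓣 : S → TorusTerms c d) (α Rσ₀ θ₀ : ℝ) : Prop :=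
  ∃ w : WalkConsts, w.Admissible α Rσ₀ ∧ SmallTheta w α θ₀ ∧ ∀ s, ∀ i : (𝓣 s).ι, TermWalkData ((𝓣 s).𝒦 i) w

/-- (v)⁺ across ⟹ (v) across (forget the smallness). [cite: Balaban1988RG2Cluster, p.15] -/
theorem across_of_acrossSmall {S : Type*} {𝓣 : S → TorusTerms c d} {α Rσ₀ θ₀ : ℝ}
    (h : ExistsUniformAcrossSmall 𝓣 α Rσ₀ θ₀) : ExistsUniformAcross 𝓣 α Rσ₀ :=
  let ⟨w, hw, _, hall⟩ := h; ⟨w, hw, hall⟩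

/-- (v)⁺ across ⟹ (v)⁺ on each member (g1-plan-2's one-torus form). [cite: Balaban1988RG2Cluster, p.15] -/
theorem uniformSmall_of_acrossSmall {S : Type*} {𝓣 : S → TorusTerms c d} {α Rσ₀ θ₀ : ℝ}
    (h : ExistsUniformAcrossSmall 𝓣 α Rσ₀ θ₀) (s : S) : ExistsWalkDataUniformSmall (𝓣 s).𝒦 α Rσ₀ θ₀ :=
  let ⟨w, hw, hs, hall⟩ := h; ⟨w, hw, hs, hall s⟩

/-- Monotone in the threshold. [cite: Balaban1988RG2Cluster, p.15] -/
theorem acrossSmall_mono {S : Type*} {𝓣 : S → TorusTerms c d} {α Rσ₀ θ₀ θ₁ : ℝ} (hθ : θ₀ ≤ θ₁)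
    (h : ExistsUniformAcrossSmall 𝓣 α Rσ₀ θ₀) : ExistsUniformAcrossSmall 𝓣 α Rσ₀ θ₁ := by
  obtain ⟨w, hw, hs, hall⟩ := h
  exact ⟨w, hw, ⟨hs.hΓ.trans hθ, hs.hE.trans hθ⟩, hall⟩

/-- HOW (v)⁺ IS MEANT TO BE MET (the shape of the G2 builder's obligation): a package `w` serving every member and term,
with `K̄_Γ, K̄_E ≤ K̄` and `2K̄(e^{−εR_σ} + α∕R) ≤ θ₀` — i.e. GENUINE decay `εR_σ ≫ 1` ([B9] Thm 3.10) and `α ≪ R`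
(bigger analyticity space), the two printed sources of smallness; via g1-plan-2's `smallTheta_of_decay`.
[cite: Balaban1988RG2Cluster, (1.11) p.5, p.15; Balaban1985BackgroundPropagators, Thm 3.10 p.416] -/
theorem acrossSmall_of_decay {S : Type*} {𝓣 : S → TorusTerms c d} {α Rσ₀ θ₀ Kbar : ℝ} (w : WalkConsts)
    (hw : w.Admissible α Rσ₀) (hall : ∀ s, ∀ i : (𝓣 s).ι, TermWalkData ((𝓣 s).𝒦 i) w)
    (hKΓ : w.KbarΓ ≤ Kbar) (hKE : w.KbarE ≤ Kbar) (hα : 0 ≤ α)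
    (hθ : 2 * Kbar * (Real.exp (-(w.ε * w.Rσ)) + α / w.R) ≤ θ₀) : ExistsUniformAcrossSmall 𝓣 α Rσ₀ θ₀ :=
  ⟨w, hw, smallTheta_of_decay w hKΓ hKE
    (add_nonneg (Real.exp_pos _).le (div_nonneg hα (hα.trans_lt hw.hαR).le)) hθ, hall⟩

end AcrossSmall

end Literature.MathematicalPhysics.QuantumFieldTheory.Balaban1983to89.B13TermWalkDataOneTorus

end
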